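import Summits.ValiantsHypothesis.ValiantsHypothesis.Theorems.MonotoneRestorationOrbitRestorationQPValueDerivationOps
import Summits.ValiantsHypothesis.ValiantsHypothesis.Theorems.MonotoneRestorationOrbitRestorationQPValueOrbitConverse
import Summits.ValiantsHypothesis.ValiantsHypothesis.Theorems.MonotoneRestorationOrbitRestorationQPTermCircuitOrbit
import HarnessLib

/-!
# Unbounded products in value derivations at no orbit cost (symmetrisation in ORBIT currency, VIII)

Route MonotoneRestoration, crux `OrbitRestorationQP` (stmt-ValiantsHypothesis-18293), namespace
`Summit.ValiantsHypothesis.ValiantsHypothesis.Theorems.ValueProducts`.  Route-independent infrastructure (no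
`Theses` import).

Value derivations (`…ValueDerivation.lean`) have BINARY products, so a long product `Π_i φ i` of values computed
by iterated multiplication passes through partial products, whose `Γ`-orbits can be exponentially larger than
the orbit of the MULTISET `{φ i}`.  Newton's identities avoid this: adjoin the powers `(φ i)^j`, the power sums
`P_j = Σ_i (φ i)^j`, the elementary symmetric values `E_k` of the multiset and the products `E_{k-i} · P_i`
(`k E_k = Σ_{i=1}^{k} (-1)^{i-1} E_{k-i} P_i`, characteristic `0`); every new value is a function of the multiset
(or of one member), so its orbit is at most the orbit of the multiset (or of the member), and `E_m = Π_i φ i`.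

* `prodAdjoin 𝒟 φ hφ` — the value derivation `𝒟` extended by the Newton data of a finite FAMILY of indexed
  families `φ s : ι → K[X]` (`s : τ`) of values of `𝒟`; `mem_prodAdjoin_S`, `prod_mem_prodAdjoin_S`
  (`Π_i φ s i` is a value), `orbit_prodAdjoin_le` (all value orbits `≤ B` if those of `𝒟` are, the multisets
  `{φ s i}_i` have orbits `≤ B`, and `B ≥ 1`).

Everything is proved. [folklore]  Reference: A. Dawar, G. Wilsenach, *Symmetric arithmetic circuits*,
ToC 21 (2025), §3.3. [DawarWilsenach2025]
-/

noncomputable section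

open scoped Classical

-- `Summit.ValiantsHypothesis.ValiantsHypothesis.…` is the tree's single-conjunct layout (Sub = Summit).
set_option linter.dupNamespace false

namespace Summit.ValiantsHypothesis.ValiantsHypothesis.Theorems

universe u v

namespace ValueProducts

open Finset SymmetricValues

variable {K : Type u} {X : Type v} [Field K]
variable {τ ι : Type} [Fintype τ] [Fintype ι] (φ : τ → ι → MvPolynomial X K)

/-! ### Newton data of an indexed family -/

/-- `E_k(s)`: the `k`-th elementary symmetric function of the multiset `{φ s i}_i`. [folklore] -/
def fE (s : τ) (k : ℕ) : MvPolynomial X K := ((univ : Finset ι).val.map (φ s)).esymm k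

/-- `P_j(s)`: the `j`-th power sum of the family `φ s`. [folklore] -/
def fP (s : τ) (j : ℕ) : MvPolynomial X K := ∑ i, φ s i ^ j

omit [Fintype τ] in
/-- `E_0 = 1`. [folklore] -/
theorem fE_zero (s : τ) : fE φ s 0 = 1 := by
  simp [fE, Multiset.esymm, Multiset.powersetCard_zero_left]

omit [Fintype τ] in
/-- `E_{|ι|} = Π_i φ s i`. [folklore] -/
theorem fE_card (s : τ) : fE φ s (Fintype.card ι) = ∏ i, φ s i := by
  rw [fE, Finset.esymm_map_val, ← Finset.card_univ, Finset.powersetCard_self, Finset.sum_singleton]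

omit [Fintype τ] in
/-- **Newton's identity** for the family (characteristic `0`, `k ≥ 1`). [folklore] -/
theorem fE_newton [CharZero K] (s : τ) {k : ℕ} (hk : 1 ≤ k) :
    fE φ s k = ∑ a ∈ newtonIdx k, MvPolynomial.C (newtonCoef (K := K) k a) * (fE φ s a.1 * fP φ s a.2) := by
  have hE : ∀ j, MvPolynomial.aeval (φ s) (MvPolynomial.esymm ι K j) = fE φ s j := fun j =>
    MvPolynomial.aeval_esymm_eq_multiset_esymm ι K j (φ s)
  have hP : ∀ j, MvPolynomial.aeval (φ s) (MvPolynomial.psum ι K j) = fP φ s j := by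
    intro j
    simp only [MvPolynomial.psum, map_sum, map_pow, MvPolynomial.aeval_X, fP]
  have H := congrArg (MvPolynomial.aeval (φ s)) (MvPolynomial.mul_esymm_eq_sum ι K k)
  simp only [map_mul, map_natCast, map_sum, map_pow, map_neg, map_one, hE, hP] at H
  have hk0 : (k : K) ≠ 0 := Nat.cast_ne_zero.2 (by omega)
  have hCk : (k : MvPolynomial X K) = MvPolynomial.C (k : K) := (map_natCast MvPolynomial.C k).symm
  have : fE φ s k = MvPolynomial.C ((k : K)⁻¹) * ((k : MvPolynomial X K) * fE φ s k) := by
    rw [hCk, ← mul_assoc, ← map_mul, inv_mul_cancel₀ hk0, map_one, one_mul]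
  rw [this, H, newtonIdx, Finset.mul_sum, Finset.mul_sum]
  refine Finset.sum_congr rfl fun a _ => ?_
  simp only [newtonCoef, map_mul, map_pow, map_neg, map_one, pow_add]
  ring

/-! ### Names, values, ranks, steps -/

/-- Names of the adjoined values. [folklore] -/
inductive PNm (τ ι : Type) : Type
  /-- The power `(φ s i)^j`. -/
  | pw (s : τ) (i : ι) (j : ℕ) : PNm τ ι
  /-- The power sum `P_j(s)`. -/
  | ps (s : τ) (j : ℕ) : PNm τ ι
  /-- The Newton product `E_{a.1}(s) · P_{a.2}(s)`. -/
  | nt (s : τ) (a : ℕ × ℕ) : PNm τ ι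
  /-- The elementary symmetric value `E_k(s)`. -/
  | es (s : τ) (k : ℕ) : PNm τ ι

/-- Values of names. [folklore] -/
def pnval : PNm τ ι → MvPolynomial X K
  | PNm.pw s i j => φ s i ^ j
  | PNm.ps s j => fP φ s j
  | PNm.nt s a => fE φ s a.1 * fP φ s a.2
  | PNm.es s k => fE φ s k

/-- The size `m = |ι|`. [folklore] -/
def m (_φ : τ → ι → MvPolynomial X K) : ℕ := Fintype.card ι
/-- Ranks of names (relative; shifted above `𝒟` later). [folklore] -/
def pnrank : PNm τ ι → ℕ
  | PNm.pw _ _ j => j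
  | PNm.ps _ j => m φ + 1 + j
  | PNm.nt _ a => 2 * m φ + 1 + 2 * (a.1 + a.2)
  | PNm.es _ k => 2 * m φ + 2 + 2 * k

/-- The step of `E_k(s)`. [folklore] -/
def esStep (s : τ) (k : ℕ) : StepData K X :=
  if k = 0 then StepData.const 1
  else StepData.sum ((newtonIdx k).val.map fun a => (newtonCoef k a, fE φ s a.1 * fP φ s a.2))

/-- Steps of names. [folklore] -/
def pstep : PNm τ ι → StepData K X
  | PNm.pw s i j => if j = 0 then StepData.const 1 else StepData.prod (φ s i ^ (j - 1)) (φ s i)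
  | PNm.ps s j => StepData.sum ((univ : Finset ι).val.map fun i => (1, φ s i ^ j))
  | PNm.nt s a => StepData.prod (fE φ s a.1) (fP φ s a.2)
  | PNm.es s k => esStep φ s k

/-- The finite set of names used. [folklore] -/
def pnames : Finset (PNm τ ι) :=
  (univ ×ˢ univ ×ˢ Icc 2 (m φ)).image (fun p => PNm.pw p.1 p.2.1 p.2.2) ∪
    (univ ×ˢ Icc 1 (m φ)).image (fun p => PNm.ps p.1 p.2) ∪
    (univ ×ˢ (Icc 1 (m φ)).biUnion newtonIdx).image (fun p => PNm.nt p.1 p.2) ∪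
    (univ ×ˢ range (m φ + 1)).image (fun p => PNm.es p.1 p.2)

/-- Powers with `2 ≤ j ≤ m` are names. [folklore] -/
theorem pw_mem {s : τ} {i : ι} {j : ℕ} (h2 : 2 ≤ j) (hM : j ≤ m φ) : PNm.pw s i j ∈ pnames φ :=
  mem_union_left _ (mem_union_left _ (mem_union_left _ (mem_image.2
    ⟨(s, i, j), mem_product.2 ⟨mem_univ s, mem_product.2 ⟨mem_univ i, mem_Icc.2 ⟨h2, hM⟩⟩⟩, rfl⟩)))

/-- Power sums with `1 ≤ j ≤ m` are names. [folklore] -/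
theorem ps_mem {s : τ} {j : ℕ} (h1 : 1 ≤ j) (hM : j ≤ m φ) : PNm.ps s j ∈ pnames φ :=
  mem_union_left _ (mem_union_left _ (mem_union_right _ (mem_image.2
    ⟨(s, j), mem_product.2 ⟨mem_univ s, mem_Icc.2 ⟨h1, hM⟩⟩, rfl⟩)))

/-- Newton products with admissible indices are names. [folklore] -/
theorem nt_mem {s : τ} {k : ℕ} {a : ℕ × ℕ} (h1 : 1 ≤ k) (hM : k ≤ m φ) (ha : a ∈ newtonIdx k) :
    PNm.nt s a ∈ pnames φ :=
  mem_union_left _ (mem_union_right _ (mem_image.2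
    ⟨(s, a), mem_product.2 ⟨mem_univ s, mem_biUnion.2 ⟨k, mem_Icc.2 ⟨h1, hM⟩, ha⟩⟩, rfl⟩))

/-- Elementary symmetric values with `k ≤ m` are names. [folklore] -/
theorem es_mem {s : τ} {k : ℕ} (hM : k ≤ m φ) : PNm.es s k ∈ pnames φ :=
  mem_union_right _ (mem_image.2 ⟨(s, k), mem_product.2 ⟨mem_univ s, mem_range.2 (by omega)⟩, rfl⟩)

/-- Parameters of power names. [folklore] -/
theorem bounds_of_pw_mem {s : τ} {i : ι} {j : ℕ} (h : PNm.pw s i j ∈ pnames φ) : 2 ≤ j ∧ j ≤ m φ := by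
  rcases mem_union.1 h with h | h
  · rcases mem_union.1 h with h | h
    · rcases mem_union.1 h with h | h
      · obtain ⟨p, hp, he⟩ := mem_image.1 h
        obtain ⟨-, -, rfl⟩ := PNm.pw.inj he
        exact mem_Icc.1 (mem_product.1 (mem_product.1 hp).2).2
      · obtain ⟨p, -, he⟩ := mem_image.1 h; cases he
    · obtain ⟨p, -, he⟩ := mem_image.1 h; cases he
  · obtain ⟨p, -, he⟩ := mem_image.1 h; cases he

/-- Parameters of power-sum names. [folklore] -/
theorem bounds_of_ps_mem {s : τ} {j : ℕ} (h : PNm.ps s j ∈ pnames φ) : 1 ≤ j ∧ j ≤ m φ := by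
  rcases mem_union.1 h with h | h
  · rcases mem_union.1 h with h | h
    · rcases mem_union.1 h with h | h
      · obtain ⟨p, -, he⟩ := mem_image.1 h; cases he
      · obtain ⟨p, hp, he⟩ := mem_image.1 h
        obtain ⟨-, rfl⟩ := PNm.ps.inj he
        exact mem_Icc.1 (mem_product.1 hp).2
    · obtain ⟨p, -, he⟩ := mem_image.1 h; cases he
  · obtain ⟨p, -, he⟩ := mem_image.1 h; cases he

/-- Parameters of Newton-product names. [folklore] -/
theorem idx_of_nt_mem {s : τ} {a : ℕ × ℕ} (h : PNm.nt s a ∈ pnames φ) :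
    ∃ k, 1 ≤ k ∧ k ≤ m φ ∧ a ∈ newtonIdx k := by
  rcases mem_union.1 h with h | h
  · rcases mem_union.1 h with h | h
    · rcases mem_union.1 h with h | h
      · obtain ⟨p, -, he⟩ := mem_image.1 h; cases he
      · obtain ⟨p, -, he⟩ := mem_image.1 h; cases he
    · obtain ⟨p, hp, he⟩ := mem_image.1 h
      obtain ⟨-, rfl⟩ := PNm.nt.inj he
      obtain ⟨k, hk, ha⟩ := mem_biUnion.1 (mem_product.1 hp).2
      exact ⟨k, (mem_Icc.1 hk).1, (mem_Icc.1 hk).2, ha⟩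
  · obtain ⟨p, -, he⟩ := mem_image.1 h; cases he

/-- Parameters of elementary-symmetric names. [folklore] -/
theorem bound_of_es_mem {s : τ} {k : ℕ} (h : PNm.es s k ∈ pnames φ) : k ≤ m φ := by
  rcases mem_union.1 h with h | h
  · rcases mem_union.1 h with h | h
    · rcases mem_union.1 h with h | h
      · obtain ⟨p, -, he⟩ := mem_image.1 h; cases he
      · obtain ⟨p, -, he⟩ := mem_image.1 h; cases he
    · obtain ⟨p, -, he⟩ := mem_image.1 h; cases he
  · obtain ⟨p, hp, he⟩ := mem_image.1 h
    obtain ⟨-, rfl⟩ := PNm.es.inj he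
    have := mem_range.1 (mem_product.1 hp).2
    omega

/-- **Every name's step computes its value.** [folklore] -/
theorem pstep_value [CharZero K] (ν : PNm τ ι) (hν : ν ∈ pnames φ) : (pstep φ ν).value = pnval φ ν := by
  cases ν with
  | pw s i j =>
    obtain ⟨h2, -⟩ := bounds_of_pw_mem φ hν
    simp only [pstep, pnval, if_neg (show j ≠ 0 by omega), StepData.value]
    rw [← pow_succ, Nat.sub_add_cancel (by omega)]
  | ps s j =>
    simp only [pstep, pnval, StepData.value, Multiset.map_map, Function.comp_def, map_one, one_mul, fP]
    rw [Finset.sum_eq_multiset_sum]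
  | nt s a => simp [pstep, pnval, StepData.value]
  | es s k =>
    simp only [pstep, pnval, esStep]
    split_ifs with hk
    · subst hk; simp [StepData.value, fE_zero]
    · simp only [StepData.value, Multiset.map_map, Function.comp_def]
      rw [fE_newton φ s (Nat.one_le_iff_ne_zero.2 hk), Finset.sum_eq_multiset_sum]

/-- **Every operand of a name's step is a base value `φ s i` or the value of a name of smaller rank.**
[folklore] -/
theorem pstep_args (ν : PNm τ ι) (hν : ν ∈ pnames φ) {u : MvPolynomial X K} (hu : u ∈ (pstep φ ν).args) :
    (∃ s i, u = φ s i) ∨ ∃ μ ∈ pnames φ, pnval φ μ = u ∧ pnrank φ μ < pnrank φ ν := by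
  cases ν with
  | pw s i j =>
    obtain ⟨h2, hM⟩ := bounds_of_pw_mem φ hν
    simp only [pstep, if_neg (show j ≠ 0 by omega), StepData.args, Multiset.insert_eq_cons,
      Multiset.mem_cons, Multiset.mem_singleton] at hu
    rcases hu with rfl | rfl
    · by_cases hj : j = 2
      · subst hj; exact Or.inl ⟨s, i, by simp⟩
      · refine Or.inr ⟨PNm.pw s i (j - 1), pw_mem φ (by omega) (by omega), rfl, ?_⟩
        simp only [pnrank]; omega
    · exact Or.inl ⟨s, i, rfl⟩
  | ps s j =>
    obtain ⟨h1, hM⟩ := bounds_of_ps_mem φ hν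
    simp only [pstep, StepData.args, Multiset.map_map, Function.comp_def, Multiset.mem_map,
      Finset.mem_val, Finset.mem_univ, true_and] at hu
    obtain ⟨i, rfl⟩ := hu
    by_cases hj : j = 1
    · subst hj; exact Or.inl ⟨s, i, by simp⟩
    · refine Or.inr ⟨PNm.pw s i j, pw_mem φ (by omega) hM, rfl, ?_⟩
      simp only [pnrank]; omega
  | nt s a =>
    obtain ⟨k, hk1, hkM, ha⟩ := idx_of_nt_mem φ hν
    obtain ⟨hsum, hlt⟩ := mem_newtonIdx.1 ha
    simp only [pstep, StepData.args, Multiset.insert_eq_cons, Multiset.mem_cons, Multiset.mem_singleton] at hu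
    rcases hu with rfl | rfl
    · refine Or.inr ⟨PNm.es s a.1, es_mem φ (by omega), rfl, ?_⟩
      simp only [pnrank]; omega
    · refine Or.inr ⟨PNm.ps s a.2, ps_mem φ (by omega) (by omega), rfl, ?_⟩
      simp only [pnrank]; omega
  | es s k =>
    have hk := bound_of_es_mem φ hν
    simp only [pstep, esStep] at hu
    by_cases hk0 : k = 0
    · subst hk0; simp [StepData.args] at hu
    · rw [if_neg hk0] at hu
      simp only [StepData.args, Multiset.map_map, Function.comp_def, Multiset.mem_map, Finset.mem_val] at hu
      obtain ⟨a, ha, rfl⟩ := hu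
      refine Or.inr ⟨PNm.nt s a, nt_mem φ (Nat.one_le_iff_ne_zero.2 hk0) hk ha, rfl, ?_⟩
      have := (mem_newtonIdx.1 ha).1
      simp only [pnrank]; omega

/-! ### The extended derivation -/

variable (𝒟 : ValueDerivation K X) (hφ : ∀ s i, φ s i ∈ 𝒟.S)

/-- The rank of a new value: the least rank of a name with that value. [folklore] -/
def vrank (q : MvPolynomial X K) : ℕ := sInf {r : ℕ | ∃ ν ∈ pnames φ, pnval φ ν = q ∧ pnrank φ ν = r}

/-- **The value derivation extended by the Newton data of the families `φ s`** (all powers, power sums,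
Newton products and elementary symmetric values, stacked above `𝒟`). [folklore] -/
def prodAdjoin [CharZero K] : ValueDerivation K X where
  S := 𝒟.S ∪ (pnames φ).image (pnval φ)
  rank := fun q => if q ∈ 𝒟.S then 𝒟.rank q else 𝒟.maxRank + 1 + vrank φ q
  step := by
    intro q hq
    by_cases h1 : q ∈ 𝒟.S
    · obtain ⟨d, hd⟩ := 𝒟.step q h1
      refine ⟨d, ⟨hd.value_eq, fun u hu => ?_⟩⟩
      obtain ⟨huS, hlt⟩ := hd.args_lt u hu
      refine ⟨mem_union_left _ huS, ?_⟩
      simp only [if_pos huS, if_pos h1]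
      exact hlt
    · have h2 : q ∈ (pnames φ).image (pnval φ) := (mem_union.1 hq).resolve_left h1
      obtain ⟨ν, hν, hq'⟩ := mem_image.1 h2
      have hne : {r : ℕ | ∃ ν ∈ pnames φ, pnval φ ν = q ∧ pnrank φ ν = r}.Nonempty := ⟨_, ν, hν, hq', rfl⟩
      obtain ⟨μ, hμ, hμq, hμr⟩ := Nat.sInf_mem hne
      refine ⟨pstep φ μ, ⟨?_, fun u hu => ?_⟩⟩
      · rw [pstep_value φ μ hμ, hμq]
      · rw [if_neg h1]
        rcases pstep_args φ μ hμ hu with ⟨s, i, rfl⟩ | ⟨κ, hκ, hκu, hlt⟩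
        · refine ⟨mem_union_left _ (hφ s i), ?_⟩
          rw [if_pos (hφ s i)]
          have := 𝒟.rank_le_maxRank (hφ s i)
          omega
        · refine ⟨mem_union_right _ (mem_image.2 ⟨κ, hκ, hκu⟩), ?_⟩
          by_cases hu1 : u ∈ 𝒟.S
          · rw [if_pos hu1]
            have := 𝒟.rank_le_maxRank hu1
            omega
          · rw [if_neg hu1]
            have h3 : vrank φ u ≤ pnrank φ κ := Nat.sInf_le ⟨κ, hκ, hκu, rfl⟩
            have h4 : pnrank φ μ = vrank φ q := hμr
            omega

/-- Membership in the extended derivation. [folklore] -/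
theorem mem_prodAdjoin_S [CharZero K] {r : MvPolynomial X K} :
    r ∈ (prodAdjoin φ 𝒟 hφ).S ↔ r ∈ 𝒟.S ∨ ∃ ν ∈ pnames φ, pnval φ ν = r := by
  change r ∈ 𝒟.S ∪ (pnames φ).image (pnval φ) ↔ _
  rw [mem_union, mem_image]

/-- Old values are values. [folklore] -/
theorem mem_prodAdjoin_S_of_mem [CharZero K] {r : MvPolynomial X K} (hr : r ∈ 𝒟.S) :
    r ∈ (prodAdjoin φ 𝒟 hφ).S :=
  (mem_prodAdjoin_S φ 𝒟 hφ).2 (Or.inl hr)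

/-- **The products `Π_i φ s i` are values of the extended derivation.** [folklore] -/
theorem prod_mem_prodAdjoin_S [CharZero K] (s : τ) : (∏ i, φ s i) ∈ (prodAdjoin φ 𝒟 hφ).S :=
  (mem_prodAdjoin_S φ 𝒟 hφ).2 (Or.inr ⟨PNm.es s (m φ), es_mem φ le_rfl, fE_card φ s⟩)

/-! ### Orbits -/

variable {Γ : Type*} [Group Γ] [Finite Γ] [MulAction Γ X]

omit [Fintype τ] [Finite Γ] in
/-- Renaming the multiset of a family. [folklore] -/
theorem map_ren_family (γ : Γ) (s : τ) :
    ((univ : Finset ι).val.map (φ s)).map (ren γ) = (univ : Finset ι).val.map (fun i => ren γ (φ s i)) := by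
  rw [Multiset.map_map]; rfl

omit [Fintype τ] in
/-- A value that is a function of the multiset `{φ s i}_i` commuting with renaming has orbit at most the
orbit of the multiset. [folklore] -/
theorem ncard_range_le_of_multiset (F : Multiset (MvPolynomial X K) → MvPolynomial X K)
    (hF : ∀ (γ : Γ) (M : Multiset (MvPolynomial X K)), ren γ (F M) = F (M.map (ren γ))) (s : τ) :
    (Set.range fun γ : Γ => ren γ (F ((univ : Finset ι).val.map (φ s)))).ncard ≤
      (Set.range fun γ : Γ => ((univ : Finset ι).val.map (φ s)).map (ren γ)).ncard :=
  TermCircuit.ncard_range_le_of_factor _ (fun γ : Γ => ((univ : Finset ι).val.map (φ s)).map (ren γ)) F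
    fun γ => hF γ _

omit [Fintype τ] [Fintype ι] [Finite Γ] in
/-- `E_k` commutes with renaming (ring homomorphisms pass through `Multiset.esymm`). [folklore] -/
theorem ren_esymm (γ : Γ) (M : Multiset (MvPolynomial X K)) (k : ℕ) :
    ren γ (M.esymm k) = (M.map (ren γ)).esymm k := by
  simp only [Multiset.esymm, map_multiset_sum, Multiset.map_map, Function.comp_def, map_multiset_prod,
    Multiset.powersetCard_map]

omit [Fintype τ] [Fintype ι] [Finite Γ] in
/-- Power sums commute with renaming. [folklore] -/
theorem ren_psum (γ : Γ) (M : Multiset (MvPolynomial X K)) (j : ℕ) :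
    ren γ ((M.map (· ^ j)).sum) = ((M.map (ren γ)).map (· ^ j)).sum := by
  rw [map_multiset_sum, Multiset.map_map, Multiset.map_map]
  congr 1
  exact Multiset.map_congr rfl fun x _ => map_pow _ _ _

omit [Fintype τ] in
/-- `P_j(s)` as a function of the multiset. [folklore] -/
theorem fP_eq (s : τ) (j : ℕ) : fP φ s j = ((((univ : Finset ι).val.map (φ s))).map (· ^ j)).sum := by
  rw [fP, Multiset.map_map, Finset.sum_eq_multiset_sum]; rfl

/-- **Orbits of the extended derivation**: bounded by `B` when the values of `𝒟` and the multisets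
`{φ s i}_i` have orbits `≤ B`. [folklore] -/
theorem orbit_prodAdjoin_le [CharZero K] {B : ℕ}
    (hS : ∀ q ∈ 𝒟.S, (Set.range fun γ : Γ => ren γ q).ncard ≤ B)
    (hM : ∀ s, (Set.range fun γ : Γ => ((univ : Finset ι).val.map (φ s)).map (ren γ)).ncard ≤ B)
    {r : MvPolynomial X K} (hr : r ∈ (prodAdjoin φ 𝒟 hφ).S) :
    (Set.range fun γ : Γ => ren γ r).ncard ≤ B := by
  rcases (mem_prodAdjoin_S φ 𝒟 hφ).1 hr with hr | ⟨ν, -, rfl⟩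
  · exact hS r hr
  · cases ν with
    | pw s i j =>
      refine le_trans ?_ (hS _ (hφ s i))
      exact TermCircuit.ncard_range_le_of_factor _ (fun γ : Γ => ren γ (φ s i)) (· ^ j)
        fun γ => map_pow _ _ _
    | ps s j =>
      refine le_trans ?_ (hM s)
      simp only [pnval, fP_eq]
      exact ncard_range_le_of_multiset φ (fun M => (M.map (· ^ j)).sum) (fun γ M => ren_psum γ M j) s
    | nt s a =>
      refine le_trans ?_ (hM s)
      simp only [pnval, fP_eq, fE]
      exact ncard_range_le_of_multiset φ (fun M => M.esymm a.1 * (M.map (· ^ a.2)).sum)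
        (fun γ M => by rw [map_mul, ren_esymm, ren_psum]) s
    | es s k =>
      refine le_trans ?_ (hM s)
      simp only [pnval, fE]
      exact ncard_range_le_of_multiset φ (fun M => M.esymm k) (fun γ M => ren_esymm γ M k) s

end ValueProducts

end Summit.ValiantsHypothesis.ValiantsHypothesis.Theorems

end
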